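import Summits.QuantumFields.YangMills.Theorems.VirialFluxGapSheetKernel
import Summits.QuantumFields.YangMills.Theorems.VirialFluxGapFixFrameStd
import HarnessLib

/-!
# Route `VirialFluxGap` (YangMills): FOUR ORTHONORMAL EXACT KERNEL VECTORS of the standard `X_fix` frame Hessian at a flat comb ring

Assignment (K) of the ⟨stmt-QuantumFields-24141⟩ `PeriodicSoftness` team, concluded in the host's letters (LEAD ruling 2026-08-30T23:30Z:
`X_fix` host, `m = 4`; fcl-p3's ✓`generic_divergence_upper` inputs (iii)): in the standard frame family ✓`fixFrameStd` of
✓`VirialFluxGapFixFrameStd` (fcl-p3's half-Pauli `stdFrame` at the `X_fix` variables), at the comb ring `p = ((fun _ => combFlat h'), fun _ => c')`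
with data on an axis `n ≠ 0` (the Taylor base point from ✓`exists_zero_near_of_regular` + ✓`exists_commuting_near_of_far_axis`), there are
FOUR ORTHONORMAL coordinate vectors in the KERNEL of the raw and of the symmetrised frame Hessian — the inputs `hon`/`hker` of
✓`generic_divergence_upper` ∕ ✓`trace_resolvent_le` and `hBk` of ✓`approxKernel_of_kernel`:

* §1 Boolean block indicators `isWrapB k` ∕ `isSeamB` on the ring variables (bridge `wrapBlockDir_eq_ite` ∕ `seamBlockDir_eq_ite` to
  ✓`wrapBlockDir` ∕ ✓`seamBlockDir`; tree links are in no block); the block directions vanish on the tree links of slice `0`, so by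
  ✓`dirOf_fixFrameStd_fixCoord` they ARE `dirOf fixFrameStd` of their `X_fix` coordinates (`dirOf_fixCoord_wrapBlockDir` ∕ `…seamBlockDir`).
* §2 the coordinates `fixCoord (wrapBlockDir k Y₀)`, `fixCoord (seamBlockDir Y₀)`: entrywise formula, pairwise ORTHOGONAL (disjoint
  supports), and NON-ZERO for `Y₀ ≠ 0` skew-Hermitian traceless (`sum_sq_pauliCoord_pos`: the slice-`0` wrap link `((−1,−1,−1),k)` resp. the
  seam site `0` carries `Σ_a pauliCoord(Y₀)_a² > 0`).
* §3 `exists_orthonormal_of_orthogonal_kernel` ∕ `exists_orthonormal_four` — normalising a pairwise orthogonal family of non-zero kernel vectors.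
* §4 ★★★ `exists_four_orthonormal_kernel_vectors` — `∃ k : Fin 4 → FixVar L × Fin 3 → ℝ`, `k a ⬝ᵥ k b = δ_ab`,
  `frameHessRaw fixFrameStd (ringCoord p) *ᵥ k a = 0` and `frameHess fixFrameStd (ringCoord p) *ᵥ k a = 0`
  (kernel by ✓`frameHessRaw_mulVec_eq_zero_of_dirOf_eq_wrapBlockDir` ∕ `…seamBlockDir` of ✓`VirialFluxGapSheetKernel`).

HONEST FRAMING: linear-algebra bookkeeping for the generic chart; the constants `K` (hence `s`), `κ`, the cut-offs, the central charts and
the assembly of «EulerFieldFix» are NOT here; ⟨24141⟩ and ⟨22884⟩ stay OPEN; no stub ∕ crux ∕ rung ∕ summit is closed; the Yang–Mills mass gap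
is NOT proved; no summit is proved by a line.  Two problem-side data definitions (`isWrapB`, `isSeamB`; no `Prop`), 0 `sorry`, standard axioms.
Width seat `ym-line-sfw-p2-w2` g51 (cell ym-idea-1, free hands), `--supports stmt-QuantumFields-24141`.  References: [cite: Luscher1983, §2]
(toron valley), [folklore].
-/

set_option autoImplicit false

noncomputable section

open scoped Matrix BigOperators Quaternion
open Matrix
open Literature.MathematicalPhysics.QuantumFieldTheory hiding SU2
open Literature.MathematicalPhysics.QuantumLattice

namespace Summit.QuantumFields.YangMills.Theorems.VirialFluxGap.FixFrame

open Summit.QuantumFields.YangMills.Theorems.FemtoTransferGap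
open Summit.QuantumFields.YangMills.Theorems.FemtoTransferGap.TT
open Summit.QuantumFields.YangMills.Theorems.FemtoTransferGap.TwoLattice
open Summit.QuantumFields.YangMills.Theorems.FemtoTransferGap.TwoLattice.Flat
open Summit.QuantumFields.YangMills.Theorems.VirialFluxGap.RingDeficit
open Summit.QuantumFields.YangMills.Theorems.VirialFluxGap.FrameDerivative
open Summit.QuantumFields.YangMills.Theorems.VirialFluxGap.FrameHessian
open Summit.QuantumFields.YangMills.Theorems.VirialFluxGap.RegularValley

variable {L : ℕ} [NeZero L]

/-! ## §1 Block indicators; the block directions have `X_fix` coordinates -/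

omit [NeZero L] in
/-- Boolean indicator of the wrap links of direction `k` (any slice) among the ring variables. [folklore] -/
def isWrapB (k : Fin 3) : (Fin (2 * L - 1 + 1) × Edge 3 L) ⊕ Site 3 L → Bool :=
  Sum.elim (fun ie => decide (ie.2.1 ie.2.2 = -1 ∧ ie.2.2 = k)) fun _ => false

omit [NeZero L] in
/-- Boolean indicator of the seam sites among the ring variables. [folklore] -/
def isSeamB : (Fin (2 * L - 1 + 1) × Edge 3 L) ⊕ Site 3 L → Bool :=
  Sum.elim (fun _ => false) fun _ => true

omit [NeZero L] in
/-- The wrap-block direction through the Boolean indicator. [folklore] -/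
theorem wrapBlockDir_eq_ite (k : Fin 3) (Y₀ : Matrix (Fin 2) (Fin 2) ℂ) (w : (Fin (2 * L - 1 + 1) × Edge 3 L) ⊕ Site 3 L) :
    wrapBlockDir (L := L) k Y₀ w = if isWrapB (L := L) k w = true then Y₀ else 0 := by
  rcases w with ie | x
  · simp only [wrapBlockDir, isWrapB, Sum.elim_inl, decide_eq_true_eq]
  · simp only [wrapBlockDir, isWrapB, Sum.elim_inr, Bool.false_eq_true, if_false]

omit [NeZero L] in
/-- The seam-block direction through the Boolean indicator. [folklore] -/
theorem seamBlockDir_eq_ite (Y₀ : Matrix (Fin 2) (Fin 2) ℂ) (w : (Fin (2 * L - 1 + 1) × Edge 3 L) ⊕ Site 3 L) :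
    seamBlockDir (L := L) Y₀ w = if isSeamB (L := L) w = true then Y₀ else 0 := by
  rcases w with ie | x
  · simp only [seamBlockDir, isSeamB, Sum.elim_inl, Bool.false_eq_true, if_false]
  · simp only [seamBlockDir, isSeamB, Sum.elim_inr, if_true]

omit [NeZero L] in
/-- A tree link of slice `0` is not a wrap link. [folklore] -/
theorem isWrapB_tree (k : Fin 3) {e : Edge 3 L} (he : treeEdge e = true) : isWrapB (L := L) k (Sum.inl (0, e)) = false := by
  simp only [isWrapB, Sum.elim_inl, decide_eq_false_iff_not, not_and]
  exact fun h _ => not_treeEdge_of_wrap h he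

omit [NeZero L] in
/-- A variable lies in at most one wrap block. [folklore] -/
theorem eq_of_isWrapB {k k' : Fin 3} {w : (Fin (2 * L - 1 + 1) × Edge 3 L) ⊕ Site 3 L} (h : isWrapB (L := L) k w = true)
    (h' : isWrapB (L := L) k' w = true) : k = k' := by
  rcases w with ie | x
  · simp only [isWrapB, Sum.elim_inl, decide_eq_true_eq] at h h'
    rw [← h.2, ← h'.2]
  · simp [isWrapB] at h

omit [NeZero L] in
/-- No variable is both a wrap link and a seam site. [folklore] -/
theorem isSeamB_eq_false_of_isWrapB {k : Fin 3} {w : (Fin (2 * L - 1 + 1) × Edge 3 L) ⊕ Site 3 L} (h : isWrapB (L := L) k w = true) :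
    isSeamB (L := L) w = false := by
  rcases w with ie | x
  · rfl
  · simp [isWrapB] at h

/-- ★ The wrap-block direction of a skew-Hermitian traceless `Y₀` is `dirOf fixFrameStd` of its `X_fix` coordinates. [folklore] -/
theorem dirOf_fixCoord_wrapBlockDir (k : Fin 3) {Y₀ : Matrix (Fin 2) (Fin 2) ℂ} (hY₀ : Y₀ᴴ = -Y₀) (hY₀0 : Y₀.trace = 0) :
    dirOf (fixFrameStd (L := L)) (fixCoord (wrapBlockDir (L := L) k Y₀)) = wrapBlockDir (L := L) k Y₀ :=
  dirOf_fixFrameStd_fixCoord (wrapBlockDir_conjTranspose k hY₀) (wrapBlockDir_trace k hY₀0) fun e he => by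
    rw [wrapBlockDir_eq_ite, isWrapB_tree k he, if_neg Bool.false_ne_true]

/-- ★ The seam-block direction of a skew-Hermitian traceless `Y₀` is `dirOf fixFrameStd` of its `X_fix` coordinates. [folklore] -/
theorem dirOf_fixCoord_seamBlockDir {Y₀ : Matrix (Fin 2) (Fin 2) ℂ} (hY₀ : Y₀ᴴ = -Y₀) (hY₀0 : Y₀.trace = 0) :
    dirOf (fixFrameStd (L := L)) (fixCoord (seamBlockDir (L := L) Y₀)) = seamBlockDir (L := L) Y₀ :=
  dirOf_fixFrameStd_fixCoord (seamBlockDir_conjTranspose hY₀) (seamBlockDir_trace hY₀0) fun e _ => by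
    simp only [seamBlockDir, Sum.elim_inl]

/-! ## §2 The sheet coordinate vectors: formula, orthogonality, positivity -/

omit [NeZero L] in
/-- The wrap sheet coordinates entrywise: `pauliCoord(Y₀)_a` on the coordinates of the wrap links of direction `k`, `0` elsewhere. [folklore] -/
theorem fixCoord_wrapBlockDir_apply (k : Fin 3) (Y₀ : Matrix (Fin 2) (Fin 2) ℂ) (va : FixVar L × Fin 3) :
    fixCoord (wrapBlockDir (L := L) k Y₀) va = if isWrapB (L := L) k (fixVar va.1) = true then pauliCoord Y₀ va.2 else 0 := by
  rw [fixCoord_apply, wrapBlockDir_eq_ite]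
  split_ifs
  · rfl
  · exact pauliCoord_zero _

omit [NeZero L] in
/-- The seam sheet coordinates entrywise. [folklore] -/
theorem fixCoord_seamBlockDir_apply (Y₀ : Matrix (Fin 2) (Fin 2) ℂ) (va : FixVar L × Fin 3) :
    fixCoord (seamBlockDir (L := L) Y₀) va = if isSeamB (L := L) (fixVar va.1) = true then pauliCoord Y₀ va.2 else 0 := by
  rw [fixCoord_apply, seamBlockDir_eq_ite]
  split_ifs
  · rfl
  · exact pauliCoord_zero _

/-- Different wrap sheet vectors are orthogonal (disjoint supports). [folklore] -/
theorem fixCoord_wrap_dot_wrap_of_ne {k k' : Fin 3} (hkk' : k ≠ k') (Y₀ : Matrix (Fin 2) (Fin 2) ℂ) :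
    fixCoord (wrapBlockDir (L := L) k Y₀) ⬝ᵥ fixCoord (wrapBlockDir (L := L) k' Y₀) = 0 := by
  refine Finset.sum_eq_zero fun va _ => ?_
  rw [fixCoord_wrapBlockDir_apply, fixCoord_wrapBlockDir_apply]
  by_cases h : isWrapB (L := L) k (fixVar va.1) = true
  · have h' : ¬ isWrapB (L := L) k' (fixVar va.1) = true := fun h' => hkk' (eq_of_isWrapB h h')
    rw [if_neg h', mul_zero]
  · rw [if_neg h, zero_mul]

/-- Wrap and seam sheet vectors are orthogonal (disjoint supports). [folklore] -/
theorem fixCoord_wrap_dot_seam (k : Fin 3) (Y₀ : Matrix (Fin 2) (Fin 2) ℂ) :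
    fixCoord (wrapBlockDir (L := L) k Y₀) ⬝ᵥ fixCoord (seamBlockDir (L := L) Y₀) = 0 := by
  refine Finset.sum_eq_zero fun va _ => ?_
  rw [fixCoord_wrapBlockDir_apply, fixCoord_seamBlockDir_apply]
  by_cases h : isWrapB (L := L) k (fixVar va.1) = true
  · rw [isSeamB_eq_false_of_isWrapB h, if_neg Bool.false_ne_true, mul_zero]
  · rw [if_neg h, zero_mul]

/-- A non-zero skew-Hermitian traceless `2×2` matrix has a non-zero half-Pauli coordinate: `Σ_a pauliCoord(Y₀)_a² > 0`. [folklore] -/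
theorem sum_sq_pauliCoord_pos {Y₀ : Matrix (Fin 2) (Fin 2) ℂ} (hY₀ : Y₀ᴴ = -Y₀) (hY₀0 : Y₀.trace = 0) (hne : Y₀ ≠ 0) :
    0 < ∑ a, pauliCoord Y₀ a ^ 2 := by
  by_contra h
  have hle : ∑ a, pauliCoord Y₀ a ^ 2 ≤ 0 := not_lt.1 h
  have hz : ∀ a, pauliCoord Y₀ a = 0 := fun a => by
    have hs := (Finset.sum_eq_zero_iff_of_nonneg fun b _ => sq_nonneg (pauliCoord Y₀ b)).1
      (le_antisymm hle (Finset.sum_nonneg fun b _ => sq_nonneg _)) a (Finset.mem_univ a)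
    exact pow_eq_zero_iff two_ne_zero |>.1 hs
  refine hne ?_
  rw [halfPauli_expand hY₀ hY₀0]
  exact Finset.sum_eq_zero fun a _ => by rw [hz a, zero_smul]

/-- A non-negative double sum is at least one of its inner sums. [folklore] -/
theorem inner_le_sum_prod {α β : Type*} [Fintype α] [Fintype β] (f : α × β → ℝ) (hf : ∀ x, 0 ≤ f x) (a₀ : α) :
    ∑ b, f (a₀, b) ≤ ∑ x, f x := by
  rw [Fintype.sum_prod_type]
  exact Finset.single_le_sum (f := fun a => ∑ b, f (a, b)) (fun a _ => Finset.sum_nonneg fun b _ => hf (a, b)) (Finset.mem_univ a₀)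

/-- ★ The wrap sheet vector is non-zero for `Y₀ ≠ 0`: the slice-`0` wrap link `((−1,−1,−1), k)` carries `Σ_a pauliCoord(Y₀)_a²`. [folklore] -/
theorem fixCoord_wrap_dot_self_pos (k : Fin 3) {Y₀ : Matrix (Fin 2) (Fin 2) ℂ} (hY₀ : Y₀ᴴ = -Y₀) (hY₀0 : Y₀.trace = 0) (hne : Y₀ ≠ 0) :
    0 < fixCoord (wrapBlockDir (L := L) k Y₀) ⬝ᵥ fixCoord (wrapBlockDir (L := L) k Y₀) := by
  have hwrap : ((fun _ : Fin 3 => (-1 : ZMod L)), k).1 k = -1 := rfl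
  set v₀ : FixVar L := Sum.inl ⟨((fun _ : Fin 3 => (-1 : ZMod L)), k), not_treeEdge_of_wrap hwrap⟩ with hv₀
  have hB : isWrapB (L := L) k (fixVar v₀) = true := by
    rw [hv₀, fixVar_off]
    simp [isWrapB]
  set f : FixVar L × Fin 3 → ℝ := fun va => fixCoord (wrapBlockDir (L := L) k Y₀) va * fixCoord (wrapBlockDir (L := L) k Y₀) va with hf
  have hinner : ∑ a, f (v₀, a) = ∑ a, pauliCoord Y₀ a ^ 2 := by
    refine Finset.sum_congr rfl fun a _ => ?_
    rw [hf]
    dsimp only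
    rw [fixCoord_wrapBlockDir_apply, if_pos hB, sq]
  calc (0 : ℝ) < ∑ a, pauliCoord Y₀ a ^ 2 := sum_sq_pauliCoord_pos hY₀ hY₀0 hne
    _ = ∑ a, f (v₀, a) := hinner.symm
    _ ≤ ∑ va, f va := inner_le_sum_prod f (fun va => mul_self_nonneg _) v₀
    _ = fixCoord (wrapBlockDir (L := L) k Y₀) ⬝ᵥ fixCoord (wrapBlockDir (L := L) k Y₀) := rfl

/-- ★ The seam sheet vector is non-zero for `Y₀ ≠ 0`: the seam site `0` carries `Σ_a pauliCoord(Y₀)_a²`. [folklore] -/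
theorem fixCoord_seam_dot_self_pos {Y₀ : Matrix (Fin 2) (Fin 2) ℂ} (hY₀ : Y₀ᴴ = -Y₀) (hY₀0 : Y₀.trace = 0) (hne : Y₀ ≠ 0) :
    0 < fixCoord (seamBlockDir (L := L) Y₀) ⬝ᵥ fixCoord (seamBlockDir (L := L) Y₀) := by
  set v₀ : FixVar L := Sum.inr (Sum.inr fun _ => 0) with hv₀
  have hB : isSeamB (L := L) (fixVar v₀) = true := by rw [hv₀, fixVar_seam]; rfl
  set f : FixVar L × Fin 3 → ℝ := fun va => fixCoord (seamBlockDir (L := L) Y₀) va * fixCoord (seamBlockDir (L := L) Y₀) va with hf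
  have hinner : ∑ a, f (v₀, a) = ∑ a, pauliCoord Y₀ a ^ 2 := by
    refine Finset.sum_congr rfl fun a _ => ?_
    rw [hf]
    dsimp only
    rw [fixCoord_seamBlockDir_apply, if_pos hB, sq]
  calc (0 : ℝ) < ∑ a, pauliCoord Y₀ a ^ 2 := sum_sq_pauliCoord_pos hY₀ hY₀0 hne
    _ = ∑ a, f (v₀, a) := hinner.symm
    _ ≤ ∑ va, f va := inner_le_sum_prod f (fun va => mul_self_nonneg _) v₀
    _ = fixCoord (seamBlockDir (L := L) Y₀) ⬝ᵥ fixCoord (seamBlockDir (L := L) Y₀) := rfl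

/-! ## §3 Normalising an orthogonal kernel family -/

/-- ★ A pairwise orthogonal family of non-zero vectors in the kernel of a matrix normalises to an ORTHONORMAL kernel family. [folklore] -/
theorem exists_orthonormal_of_orthogonal_kernel {ι : Type*} [Fintype ι] {m : ℕ} (κ : Fin m → ι → ℝ)
    (horth : ∀ a b, a ≠ b → κ a ⬝ᵥ κ b = 0) (hpos : ∀ a, 0 < κ a ⬝ᵥ κ a) {B : Matrix ι ι ℝ} (hker : ∀ a, B *ᵥ κ a = 0) :
    ∃ k : Fin m → ι → ℝ, (∀ a b, k a ⬝ᵥ k b = if a = b then 1 else 0) ∧ ∀ a, B *ᵥ k a = 0 := by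
  refine ⟨fun a => (Real.sqrt (κ a ⬝ᵥ κ a))⁻¹ • κ a, fun a b => ?_, fun a => ?_⟩
  · rw [smul_dotProduct, dotProduct_smul, smul_eq_mul, smul_eq_mul]
    split_ifs with hab
    · subst hab
      set s := Real.sqrt (κ a ⬝ᵥ κ a) with hs_def
      have hs : s ≠ 0 := (Real.sqrt_pos.2 (hpos a)).ne'
      have hsq : s * s = κ a ⬝ᵥ κ a := Real.mul_self_sqrt (hpos a).le
      rw [← hsq, ← mul_assoc s⁻¹ s s, inv_mul_cancel₀ hs, one_mul, inv_mul_cancel₀ hs]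
    · rw [horth a b hab, mul_zero, mul_zero]
  · rw [Matrix.mulVec_smul, hker a, smul_zero]

/-- ★ Four named pairwise orthogonal non-zero kernel vectors normalise to an orthonormal kernel family indexed by `Fin 4`. [folklore] -/
theorem exists_orthonormal_four {ι : Type*} [Fintype ι] (x₀ x₁ x₂ x₃ : ι → ℝ)
    (h01 : x₀ ⬝ᵥ x₁ = 0) (h02 : x₀ ⬝ᵥ x₂ = 0) (h03 : x₀ ⬝ᵥ x₃ = 0) (h12 : x₁ ⬝ᵥ x₂ = 0) (h13 : x₁ ⬝ᵥ x₃ = 0) (h23 : x₂ ⬝ᵥ x₃ = 0)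
    (hp0 : 0 < x₀ ⬝ᵥ x₀) (hp1 : 0 < x₁ ⬝ᵥ x₁) (hp2 : 0 < x₂ ⬝ᵥ x₂) (hp3 : 0 < x₃ ⬝ᵥ x₃)
    {B : Matrix ι ι ℝ} (hk0 : B *ᵥ x₀ = 0) (hk1 : B *ᵥ x₁ = 0) (hk2 : B *ᵥ x₂ = 0) (hk3 : B *ᵥ x₃ = 0) :
    ∃ k : Fin 4 → ι → ℝ, (∀ a b, k a ⬝ᵥ k b = if a = b then 1 else 0) ∧ ∀ a, B *ᵥ k a = 0 := by
  have h10 : x₁ ⬝ᵥ x₀ = 0 := by rw [dotProduct_comm]; exact h01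
  have h20 : x₂ ⬝ᵥ x₀ = 0 := by rw [dotProduct_comm]; exact h02
  have h30 : x₃ ⬝ᵥ x₀ = 0 := by rw [dotProduct_comm]; exact h03
  have h21 : x₂ ⬝ᵥ x₁ = 0 := by rw [dotProduct_comm]; exact h12
  have h31 : x₃ ⬝ᵥ x₁ = 0 := by rw [dotProduct_comm]; exact h13
  have h32 : x₃ ⬝ᵥ x₂ = 0 := by rw [dotProduct_comm]; exact h23
  refine exists_orthonormal_of_orthogonal_kernel ![x₀, x₁, x₂, x₃] ?_ ?_ ?_
  · intro a b hab
    fin_cases a <;> fin_cases b <;> first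
      | exact absurd rfl hab
      | assumption
  · intro a
    fin_cases a
    · exact hp0
    · exact hp1
    · exact hp2
    · exact hp3
  · intro a
    fin_cases a
    · exact hk0
    · exact hk1
    · exact hk2
    · exact hk3

/-! ## §4 The four orthonormal kernel vectors at a flat comb ring -/

/-- `quatMatrix` of a non-zero pure imaginary quaternion is non-zero. [folklore] -/
theorem quatMatrix_im_ne_zero {n₁ n₂ n₃ : ℝ} (hn : 0 < n₁ ^ 2 + n₂ ^ 2 + n₃ ^ 2) : quatMatrix (⟨0, n₁, n₂, n₃⟩ : ℍ) ≠ 0 := by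
  intro h
  have h00 := congr_fun (congr_fun h 0) 0
  have h01 := congr_fun (congr_fun h 0) 1
  simp only [quatMatrix, Matrix.of_apply, Matrix.cons_val', Matrix.cons_val_zero, Matrix.cons_val_one, Matrix.cons_val_fin_one,
    Matrix.zero_apply, Complex.ext_iff, Complex.zero_re, Complex.zero_im] at h00 h01
  nlinarith [h00.2, h01.1, h01.2]

/-- ★★★ **FOUR ORTHONORMAL EXACT KERNEL VECTORS of the standard `X_fix` frame Hessian at a flat comb ring.**  Comb data `h'`, `c'` with
quaternions on the axis `(n₁,n₂,n₃) ≠ 0`; at `p = ((fun _ => combFlat h'), fun _ => c')`, in the frame family ✓`fixFrameStd`, there is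
`k : Fin 4 → ι → ℝ` with `k a ⬝ᵥ k b = δ_ab`, `Ĥ(p) k_a = 0` and `H(p) k_a = 0` — inputs `hon`/`hker` of ✓`generic_divergence_upper`
(`m = 4`) and `hBk` of ✓`approxKernel_of_kernel`. [cite: Luscher1983, §2] -/
theorem exists_four_orthonormal_kernel_vectors (n₁ n₂ n₃ : ℝ) (hn : 0 < n₁ ^ 2 + n₂ ^ 2 + n₃ ^ 2) {h' : Fin 3 → SU2} {c' : SU2}
    {th : Fin 3 → ℝ} {tc : ℝ}
    (hh' : ∀ j, (su2Quat (h' j)).imI = th j * n₁ ∧ (su2Quat (h' j)).imJ = th j * n₂ ∧ (su2Quat (h' j)).imK = th j * n₃)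
    (hc' : (su2Quat c').imI = tc * n₁ ∧ (su2Quat c').imJ = tc * n₂ ∧ (su2Quat c').imK = tc * n₃) :
    ∃ k : Fin 4 → FixVar L × Fin 3 → ℝ, (∀ a b, k a ⬝ᵥ k b = if a = b then 1 else 0) ∧
      (∀ a, frameHessRaw (L := L) fixFrameStd (ringCoord L (((fun _ => combFlat h'), fun _ => c') :
          (Fin (2 * L - 1 + 1) → GaugeConfig 3 L SU2) × (Site 3 L → SU2))) *ᵥ k a = 0) ∧
      ∀ a, frameHess (L := L) fixFrameStd (ringCoord L (((fun _ => combFlat h'), fun _ => c') :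
          (Fin (2 * L - 1 + 1) → GaugeConfig 3 L SU2) × (Site 3 L → SU2))) *ᵥ k a = 0 := by
  set Q : Matrix (Fin 2) (Fin 2) ℂ := quatMatrix (⟨0, n₁, n₂, n₃⟩ : ℍ) with hQ
  have hQh : Qᴴ = -Q := quatMatrix_im_conjTranspose n₁ n₂ n₃
  have hQ0 : Q.trace = 0 := quatMatrix_im_trace n₁ n₂ n₃
  have hQne : Q ≠ 0 := quatMatrix_im_ne_zero hn
  set p : (Fin (2 * L - 1 + 1) → GaugeConfig 3 L SU2) × (Site 3 L → SU2) := ((fun _ => combFlat h'), fun _ => c') with hp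
  have hp0 : ringDeficit L (fun _ => false) p = 0 := by
    have h := ringDeficit_comb_seamSheet_eq_zero (L := L) n₁ n₂ n₃ hh' hc' 0
    rwa [multiCurve_zero, mul_one] at h
  -- kernel
  have hkerW : ∀ k : Fin 3, frameHessRaw (L := L) fixFrameStd (ringCoord L p) *ᵥ fixCoord (wrapBlockDir (L := L) k Q) = 0 := fun k =>
    frameHessRaw_mulVec_eq_zero_of_dirOf_eq_wrapBlockDir fixFrameStd fixFrameStd_conjTranspose fixFrameStd_trace n₁ n₂ n₃ hh' hc' k
      (dirOf_fixCoord_wrapBlockDir k hQh hQ0)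
  have hkerS : frameHessRaw (L := L) fixFrameStd (ringCoord L p) *ᵥ fixCoord (seamBlockDir (L := L) Q) = 0 :=
    frameHessRaw_mulVec_eq_zero_of_dirOf_eq_seamBlockDir fixFrameStd fixFrameStd_conjTranspose fixFrameStd_trace n₁ n₂ n₃ hh' hc'
      (dirOf_fixCoord_seamBlockDir hQh hQ0)
  obtain ⟨k, hon, hk⟩ := exists_orthonormal_four (fixCoord (wrapBlockDir (L := L) 0 Q)) (fixCoord (wrapBlockDir (L := L) 1 Q))
    (fixCoord (wrapBlockDir (L := L) 2 Q)) (fixCoord (seamBlockDir (L := L) Q))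
    (fixCoord_wrap_dot_wrap_of_ne (by decide) Q) (fixCoord_wrap_dot_wrap_of_ne (by decide) Q) (fixCoord_wrap_dot_seam 0 Q)
    (fixCoord_wrap_dot_wrap_of_ne (by decide) Q) (fixCoord_wrap_dot_seam 1 Q) (fixCoord_wrap_dot_seam 2 Q)
    (fixCoord_wrap_dot_self_pos 0 hQh hQ0 hQne) (fixCoord_wrap_dot_self_pos 1 hQh hQ0 hQne) (fixCoord_wrap_dot_self_pos 2 hQh hQ0 hQne)
    (fixCoord_seam_dot_self_pos hQh hQ0 hQne) (hkerW 0) (hkerW 1) (hkerW 2) hkerS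
  refine ⟨k, hon, hk, fun a => ?_⟩
  rw [frameHess_eq_frameHessRaw_of_zero fixFrameStd fixFrameStd_conjTranspose hp0]
  exact hk a

end Summit.QuantumFields.YangMills.Theorems.VirialFluxGap.FixFrame

end
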